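import Mathlib.RingTheory.GradedAlgebra.Homogeneous.Ideal
import Summits.ResolutionOfSingularities.ResolutionOfSingularities.Theorems.WeightedInvariantHypersurfaceLocalGameEFT4SDimLEDoorGradedHom
import Summits.ResolutionOfSingularities.ResolutionOfSingularities.Theorems.WeightedInvariantJOpenPresentationLE3Defs
import HarnessLib

/-!
# SPEC (Δ11) RING-LEVEL WORDS, VERBATIM — the homogeneous (open″)≤3 chart bodies of the E2 centre piece (C-c)
# (registrar res-L1-w43-plan-1, `L/res-L1-w43-plan-1/E2Step_split_sketch.lean` rev 9/10 (Δ11) section; RULING 2026-08-27T20:01:42Z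
# «land NOW as `Theorems/WeightedInvariantE2HomogeneousChartDefs.lean` … the RING-LEVEL words VERBATIM … LEAVE OUT the two SCHEME-LEVEL words»)

[OURS · L1 W4.3 · DOOR `HypersurfaceCentreConstruction` stmt-ResolutionOfSingularities-19897 · E2 tier, centre piece (C-c)
`E2CentreGlueBody`, DESIGN MEMO v0 `L/res-L1-w43-plan-1/E2-CENTRE-GLUE-DESIGN-v0.md` §2 (G-0); typer = the (G-0-abc) hand res-L1-s36-pv-1 at the
registrar's word.  Candidate DEFINITIONS (design objects of the line) + two trivial glues; nothing is asserted; nothing here is a statement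
of, or about, the manuscript under adjudication (Hironaka 2017, [claim: Hironaka2017, status: under-review]); AI planning/typing, weaker than
expert review.]

Contents (registrar's anchors in the sketch): `JOpenBodyLE3Hom` (l.600: the (open″)≤3 body `JOpenLE3.JOpenBodyLE3` with the localising element `h`
AND every parameter `U i` HOMOGENEOUS for a `ℤʲ`-grading `𝒜`, plus (reg) cotangent-independence of `U` along `V(U) ∩ D(h)`) · projection
`JOpenBodyLE3Hom.toJOpenBodyLE3` (l.624) · (G-0) `E2HomogeneousChartBody p ι J` (l.638) · seam `jOpenBodyLE3_of_pRungGrHomLE` (l.672) ·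
`JOpenBodyLE3HomU` (l.697: homogeneous `U i`, `h` free, no (reg)) · (G-0-U) `E2HomogeneousSpanBody p ι J` (l.718, board (o47-c-U), hand res-D-pv-031) ·
(G-0-abc) `E2HomChartOfHomUBody p ι J` (l.735, hand res-L1-s36-pv-1: target `LocalEngine.e2HomChartOfHomU : PRungGrHomLE 3 p ι J → E2HomChartOfHomUBody p ι J`) ·
glue `E2HomogeneousChartBody_of_homU` (l.751, PROVED).  Consumers: res-D-pv-048's scheme glue (SPEC (Δ11b) rev 10 words, landed with its F2b/F3)
and 031's assembly `…ELadderTwoCentreAssembly` (`LocalEngine.E2CentreGlueBody`).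
-/

noncomputable section

set_option linter.dupNamespace false

open IsLocalRing
open Literature.AlgebraicGeometry.Resolution
open Summit.ResolutionOfSingularities.ResolutionOfSingularities.Theorems

namespace Summit.ResolutionOfSingularities.ResolutionOfSingularities.Cruxes.HypersurfaceCentreConstruction.LocalEngine

/-- **`JOpenBodyLE3` WITH `h` AND EVERY `U i` HOMOGENEOUS, PLUS (reg)** for a grading `𝒜` of `A` (rev 9: + `∀ i, IsHomogeneousElem 𝒜 (U i)` and
+ (reg) «`U` is cotangent-independent in `A_𝔮` at EVERY prime `𝔮 ⊇ (U)` of `D(h)`» — res-D-pv-048's INTERFACE NOTE 19:36:04Z: the (M2) agreement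
tool `E2Model.le_weightedMonomialIdeal_iff_forall_map_le` (`hloc`) and (G-5) `IsWeightedChart.linearIndependent` read independence along
`V(U) ∩ D(h)`, not only at `𝔪`; all other clauses VERBATIM `JOpenLE3.JOpenBodyLE3`, …JOpenPresentationLE3Defs l.66). [OURS · candidate · registrar SPEC (Δ11)] [folklore] -/
def JOpenBodyLE3Hom {j : ℕ} {A : Type} [CommRing A] (𝒜 : (Fin j → ℤ) → AddSubgroup A)
    (ι : (R : Type) → [CommRing R] → R → Ordinal.{0}) (J : (R : Type) → [CommRing R] → R → ℕ → Ideal R)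
    (𝔪 : Ideal A) [𝔪.IsPrime] (F : A) : Prop :=
  ∃ h : A, h ∉ 𝔪 ∧ SetLike.IsHomogeneousElem 𝒜 h ∧ ∃ (N : ℕ) (U : Fin N → A) (W : Fin N → ℕ), (∀ i, 0 < W i) ∧
    (∀ i, SetLike.IsHomogeneousElem 𝒜 (U i)) ∧
    (∃ hU : ∀ i, algebraMap A (Localization.AtPrime 𝔪) (U i) ∈ maximalIdeal (Localization.AtPrime 𝔪),
      LinearIndependent (ResidueField (Localization.AtPrime 𝔪))
        (fun i => ((maximalIdeal (Localization.AtPrime 𝔪)).toCotangent ⟨_, hU i⟩ :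
          CotangentSpace (Localization.AtPrime 𝔪)))) ∧
    (∀ (𝔮 : Ideal A) [𝔮.IsPrime], h ∉ 𝔮 → (∀ i, U i ∈ 𝔮) →
      ∃ hU𝔮 : ∀ i, algebraMap A (Localization.AtPrime 𝔮) (U i) ∈ maximalIdeal (Localization.AtPrime 𝔮),
        LinearIndependent (ResidueField (Localization.AtPrime 𝔮))
          (fun i => ((maximalIdeal (Localization.AtPrime 𝔮)).toCotangent ⟨_, hU𝔮 i⟩ :
            CotangentSpace (Localization.AtPrime 𝔮)))) ∧
    ∀ (𝔮 : Ideal A) [𝔮.IsPrime], h ∉ 𝔮 → ringKrullDim (Localization.AtPrime 𝔮) ≤ (3 : ℕ) →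
      ((∀ i, U i ∈ 𝔮) ↔
        (algebraMap A (Localization.AtPrime 𝔮) F ∈ (maximalIdeal (Localization.AtPrime 𝔮)) ^ 2 ∧
          ι (Localization.AtPrime 𝔮) (algebraMap A (Localization.AtPrime 𝔮) F) =
            ι (Localization.AtPrime 𝔪) (algebraMap A (Localization.AtPrime 𝔪) F))) ∧
      ((∀ i, U i ∈ 𝔮) → ∀ m : ℕ,
        J (Localization.AtPrime 𝔮) (algebraMap A (Localization.AtPrime 𝔮) F) m =
          (weightedMonomialIdeal U W m).map (algebraMap A (Localization.AtPrime 𝔮)))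

/-- The homogeneous body forgets to the plain body. [OURS · registrar SPEC (Δ11)] [folklore] -/
theorem JOpenBodyLE3Hom.toJOpenBodyLE3 {j : ℕ} {A : Type} [CommRing A] {𝒜 : (Fin j → ℤ) → AddSubgroup A}
    {ι : (R : Type) → [CommRing R] → R → Ordinal.{0}} {J : (R : Type) → [CommRing R] → R → ℕ → Ideal R}
    {𝔪 : Ideal A} [𝔪.IsPrime] {F : A} (h : JOpenBodyLE3Hom 𝒜 ι J 𝔪 F) : JOpenLE3.JOpenBodyLE3 ι J A 𝔪 F := by
  obtain ⟨h, hh, _, N, U, W, hW, _, hU, _, hcl⟩ := h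
  exact ⟨h, hh, N, U, W, hW, hU, hcl⟩

/-- (G-0) **HOMOGENEOUS CHART = board item (o47-c-ring), THE NEW LEMMA of (C-c)** (memo §2; size M–L): on a `ℤʲ`-GRADED finite-type
`k₀`-algebra `A` (constants in degree `0`), at a HOMOGENEOUS prime `𝔪` with GRADED-SIMPLE quotient (= the orbit-generic text), for HOMOGENEOUS `F`
with `A_𝔪` regular of dimension `≤ 3` and `0 ≠ F ∈ 𝔪² A_𝔪`: the (open″)≤3 body holds with the localising element `h` HOMOGENEOUS.  Why needed: a
closed point `z` of the support lies in the model chart at the orbit-generic point `η(z)` iff `h ∉ 𝔪_z`, and `h ∉ 𝔭(η(z)) = core(𝔪_z)` forces this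
exactly when `h` is homogeneous (memo §2).  Candidate proof: the validity locus of a presentation is open and contains `𝔪`; `ι`, `J`, `F ∈ 𝔪²`,
`dim` are invariant under the generic torus translate `A → A ⊗ k₀(T)` localised ((c11)≤3 + iso/unit invariance — needed because `k₀` may be finite),
so the closure of the bad set has a homogeneous radical `⊄ 𝔪`, which contains a homogeneous `h' ∉ 𝔪` by graded-simplicity; re-present on `D(h h')`.
[OURS · candidate · registrar SPEC (Δ11)] [folklore] -/
def E2HomogeneousChartBody (p : ℕ) (ι : (R : Type) → [CommRing R] → R → Ordinal.{0})
    (J : (R : Type) → [CommRing R] → R → ℕ → Ideal R) : Prop :=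
  ∀ (k₀ : Type) [Field k₀] [CharP k₀ p] [PerfectField k₀]
    (A : Type) [CommRing A] [Algebra k₀ A] [Algebra.FiniteType k₀ A]
    (j : ℕ) (𝒜 : (Fin j → ℤ) → AddSubgroup A) [GradedRing 𝒜],
    (∀ c : k₀, algebraMap k₀ A c ∈ 𝒜 0) →
    ∀ (𝔪 : Ideal A) [𝔪.IsPrime] (F : A), 𝔪.IsHomogeneous 𝒜 →
    (∀ (d : Fin j → ℤ) (x : A), x ∈ 𝒜 d → x ∉ 𝔪 → IsUnit (Ideal.Quotient.mk 𝔪 x)) →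
    SetLike.IsHomogeneousElem 𝒜 F →
    IsRegularLocalRing (Localization.AtPrime 𝔪) →
    ringKrullDim (Localization.AtPrime 𝔪) ≤ (3 : ℕ) →
    algebraMap A (Localization.AtPrime 𝔪) F ≠ 0 →
    algebraMap A (Localization.AtPrime 𝔪) F ∈ (maximalIdeal (Localization.AtPrime 𝔪)) ^ 2 →
    JOpenBodyLE3Hom 𝒜 ι J 𝔪 F

/-- (G-0) restricted to the plain body is the rung's own (open″)≤3 (sanity seam: the homogeneous chart body STRENGTHENS h8 only in `h`).
[OURS · registrar SPEC (Δ11)] [folklore] -/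
theorem jOpenBodyLE3_of_pRungGrHomLE {p : ℕ} {ι : (R : Type) → [CommRing R] → R → Ordinal.{0}}
    {J : (R : Type) → [CommRing R] → R → ℕ → Ideal R} (hr : PRungGrHomLE 3 p ι J)
    (k₀ : Type) [Field k₀] [CharP k₀ p] [PerfectField k₀]
    (A : Type) [CommRing A] [Algebra k₀ A] [Algebra.FiniteType k₀ A] (𝔪 : Ideal A) [𝔪.IsPrime] (F : A)
    (hreg : IsRegularLocalRing (Localization.AtPrime 𝔪)) (hdim : ringKrullDim (Localization.AtPrime 𝔪) ≤ (3 : ℕ))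
    (hF0 : algebraMap A (Localization.AtPrime 𝔪) F ≠ 0)
    (hF2 : algebraMap A (Localization.AtPrime 𝔪) F ∈ (maximalIdeal (Localization.AtPrime 𝔪)) ^ 2) :
    JOpenLE3.JOpenBodyLE3 ι J A 𝔪 F :=
  (JOpenLE3.jOpenPresentationForallSingLE_three_iff p ι J).mp hr.1.2.2.2.2.2.2.2.1 k₀ A 𝔪 F hreg hdim hF0 hF2

/-- **`JOpenBodyLE3` WITH EVERY PARAMETER `U i` HOMOGENEOUS** (rev 9: elementwise, was `(U)` homogeneous; localising element `h` arbitrary, no (reg);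
all other clauses VERBATIM).
[OURS · candidate · registrar SPEC (Δ11) rev 8] [folklore] -/
def JOpenBodyLE3HomU {j : ℕ} {A : Type} [CommRing A] (𝒜 : (Fin j → ℤ) → AddSubgroup A)
    (ι : (R : Type) → [CommRing R] → R → Ordinal.{0}) (J : (R : Type) → [CommRing R] → R → ℕ → Ideal R)
    (𝔪 : Ideal A) [𝔪.IsPrime] (F : A) : Prop :=
  ∃ h : A, h ∉ 𝔪 ∧ ∃ (N : ℕ) (U : Fin N → A) (W : Fin N → ℕ), (∀ i, 0 < W i) ∧
    (∀ i, SetLike.IsHomogeneousElem 𝒜 (U i)) ∧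
    (∃ hU : ∀ i, algebraMap A (Localization.AtPrime 𝔪) (U i) ∈ maximalIdeal (Localization.AtPrime 𝔪),
      LinearIndependent (ResidueField (Localization.AtPrime 𝔪))
        (fun i => ((maximalIdeal (Localization.AtPrime 𝔪)).toCotangent ⟨_, hU i⟩ :
          CotangentSpace (Localization.AtPrime 𝔪)))) ∧
    ∀ (𝔮 : Ideal A) [𝔮.IsPrime], h ∉ 𝔮 → ringKrullDim (Localization.AtPrime 𝔮) ≤ (3 : ℕ) →
      ((∀ i, U i ∈ 𝔮) ↔
        (algebraMap A (Localization.AtPrime 𝔮) F ∈ (maximalIdeal (Localization.AtPrime 𝔮)) ^ 2 ∧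
          ι (Localization.AtPrime 𝔮) (algebraMap A (Localization.AtPrime 𝔮) F) =
            ι (Localization.AtPrime 𝔪) (algebraMap A (Localization.AtPrime 𝔪) F))) ∧
      ((∀ i, U i ∈ 𝔮) → ∀ m : ℕ,
        J (Localization.AtPrime 𝔮) (algebraMap A (Localization.AtPrime 𝔮) F) m =
          (weightedMonomialIdeal U W m).map (algebraMap A (Localization.AtPrime 𝔮)))

/-- (G-0-U) **HOMOGENEOUS-SPAN PRESENTATION = board item (o47-c-U)** (size M; route (U-a)(U-b)(U-c) above): at a homogeneous prime with
graded-simple quotient of a graded finite-type algebra, for homogeneous `F`, the (open″)≤3 body holds with `(U)` HOMOGENEOUS.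
[OURS · candidate · registrar SPEC (Δ11) rev 8] [folklore] -/
def E2HomogeneousSpanBody (p : ℕ) (ι : (R : Type) → [CommRing R] → R → Ordinal.{0})
    (J : (R : Type) → [CommRing R] → R → ℕ → Ideal R) : Prop :=
  ∀ (k₀ : Type) [Field k₀] [CharP k₀ p] [PerfectField k₀]
    (A : Type) [CommRing A] [Algebra k₀ A] [Algebra.FiniteType k₀ A]
    (j : ℕ) (𝒜 : (Fin j → ℤ) → AddSubgroup A) [GradedRing 𝒜],
    (∀ c : k₀, algebraMap k₀ A c ∈ 𝒜 0) →
    ∀ (𝔪 : Ideal A) [𝔪.IsPrime] (F : A), 𝔪.IsHomogeneous 𝒜 →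
    (∀ (d : Fin j → ℤ) (x : A), x ∈ 𝒜 d → x ∉ 𝔪 → IsUnit (Ideal.Quotient.mk 𝔪 x)) →
    SetLike.IsHomogeneousElem 𝒜 F →
    IsRegularLocalRing (Localization.AtPrime 𝔪) →
    ringKrullDim (Localization.AtPrime 𝔪) ≤ (3 : ℕ) →
    algebraMap A (Localization.AtPrime 𝔪) F ≠ 0 →
    algebraMap A (Localization.AtPrime 𝔪) F ∈ (maximalIdeal (Localization.AtPrime 𝔪)) ^ 2 →
    JOpenBodyLE3HomU 𝒜 ι J 𝔪 F

/-- (G-0-abc) **HOMOGENEOUS SHRINK GIVEN A HOMOGENEOUS-SPAN PRESENTATION = res-L1-s36-pv-1's object** (its SHAPE LINE (a)+(b)+(c), pointwise):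
at each graded orbit-generic position, `JOpenBodyLE3HomU → JOpenBodyLE3Hom`. [OURS · candidate · registrar SPEC (Δ11) rev 8] [folklore] -/
def E2HomChartOfHomUBody (p : ℕ) (ι : (R : Type) → [CommRing R] → R → Ordinal.{0})
    (J : (R : Type) → [CommRing R] → R → ℕ → Ideal R) : Prop :=
  ∀ (k₀ : Type) [Field k₀] [CharP k₀ p] [PerfectField k₀]
    (A : Type) [CommRing A] [Algebra k₀ A] [Algebra.FiniteType k₀ A]
    (j : ℕ) (𝒜 : (Fin j → ℤ) → AddSubgroup A) [GradedRing 𝒜],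
    (∀ c : k₀, algebraMap k₀ A c ∈ 𝒜 0) →
    ∀ (𝔪 : Ideal A) [𝔪.IsPrime] (F : A), 𝔪.IsHomogeneous 𝒜 →
    (∀ (d : Fin j → ℤ) (x : A), x ∈ 𝒜 d → x ∉ 𝔪 → IsUnit (Ideal.Quotient.mk 𝔪 x)) →
    SetLike.IsHomogeneousElem 𝒜 F →
    IsRegularLocalRing (Localization.AtPrime 𝔪) →
    ringKrullDim (Localization.AtPrime 𝔪) ≤ (3 : ℕ) →
    algebraMap A (Localization.AtPrime 𝔪) F ≠ 0 →
    algebraMap A (Localization.AtPrime 𝔪) F ∈ (maximalIdeal (Localization.AtPrime 𝔪)) ^ 2 →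
    JOpenBodyLE3HomU 𝒜 ι J 𝔪 F → JOpenBodyLE3Hom 𝒜 ι J 𝔪 F

/-- **GLUE (PROVED, trivially): (G-0-U) + (G-0-abc) give (G-0).** [OURS · registrar SPEC (Δ11) rev 8] -/
theorem E2HomogeneousChartBody_of_homU (p : ℕ) (ι : (R : Type) → [CommRing R] → R → Ordinal.{0})
    (J : (R : Type) → [CommRing R] → R → ℕ → Ideal R) (hU : E2HomogeneousSpanBody p ι J)
    (habc : E2HomChartOfHomUBody p ι J) : E2HomogeneousChartBody p ι J := by
  intro k₀ _ _ _ A _ _ _ j 𝒜 _ h0 𝔪 _ F h𝔪 hgs hF hreg hdim hF0 hF2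
  exact habc k₀ A j 𝒜 h0 𝔪 F h𝔪 hgs hF hreg hdim hF0 hF2 (hU k₀ A j 𝒜 h0 𝔪 F h𝔪 hgs hF hreg hdim hF0 hF2)

end Summit.ResolutionOfSingularities.ResolutionOfSingularities.Cruxes.HypersurfaceCentreConstruction.LocalEngine

end
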